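import Literature.Analysis.FluidPDE.NSVorticityBoundedTopQuant
import Literature.Analysis.FluidPDE.NSBoundedTimeHolderTopQuant
import Literature.Analysis.FluidPDE.SereginSverakLocalEnergy
import Literature.Analysis.FluidPDE.SereginSverakBlowupAlternativeAssembly
import Literature.Analysis.FluidPDE.SereginSverakBlowupCompactnessProofs
import Literature.Analysis.FluidPDE.SereginSverakScaledEnergyHolds
import Literature.Analysis.FluidPDE.SereginSverakInteriorContinuityHolds
import Literature.Analysis.FluidPDE.KNSSThm53OfWindow
import Literature.Analysis.FluidPDE.NSBoundedSuitableEnergy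
import HarnessLib

/-!
# Seregin–Šverák 2009, §4: `LocalHolderBound`, `BlowupCompactness`, `BlowupAlternative` discharged

Analysis/FluidPDE proofs file (theorems only; no definitions, no named facts) for the named
facts of `SereginSverakBlowup.lean` and `SereginSverakAxisymmetric.lean` vendoring step (iv) of
§4 of G. Seregin, V. Šverák, *On Type I singularities of the local axi-symmetric solutions of
the Navier–Stokes equations*, Comm. PDE 34 (2009) 171–201 = arXiv:0804.1803 (p. 11; reprinted
verbatim in G. Seregin, *Lecture notes on regularity theory for the Navier–Stokes equations*
(2014), §6.5, pp. 122–125):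

* `SereginSverak2009.LocalHolderBound_holds` — the uniform local Hölder bound on the blow-up
  sequence ("`‖F^k‖_{3/2,Q(4a)} ≤ c₁(a)` … By the embedding theorem, sequence `u^k` is uniformly
  bounded in the parabolic Hölder space `C^{1/2}(Q̄(a/2))`"), for one solution with constants
  uniform in the data `|u| ≤ 1`, `∫_{Q(4a)} |p|^{3/2} ≤ c`;
* `SereginSverak2009.BlowupCompactness_holds`, `SereginSverak2009.BlowupAlternative_holds`,
  `SereginSverak2009.BlowupAlternativeTypeI_holds` — the blow-up step, through the accepted
  reductions `blowupCompactness_of_localHolderBound`, `blowupAlternative_of_library_facts`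
  (with `NSBoundedSpatialHolder_holds`) and `blowupAlternativeTypeI_of_localHolderBound` (with
  `InteriorContinuity_holds`);
* `SereginSverak2009.isRegularAtOrigin_of_axisDecay_holds` — **Theorem 3.2 of the paper,
  unconditionally** (standing assumptions, axial symmetry, (r2), (r4) ⇒ `z = 0` regular), the
  accepted assembly `isRegularAtOrigin_of_axisDecay_of_library_facts` fed with the discharged
  inputs and KNSS 2009, Thm. 5.3 (`KNSS2009_liouville_bound_C_over_r_holds`);
* `SereginSverak2009.isRegularAtOrigin_of_typeI_of_axisDecayBound` — Theorem 3.1 conditional on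
  Prop. 3.7 (`AxisDecayBound`) alone.

## The proof of `LocalHolderBound`

The print runs through [LSU] (`∇u^k ∈ L_{3/2}`) and the local `L_p` theory of the Stokes system
[S8] bootstrapped in mixed norms (vendored as `StokesLocalW21Estimate`, not yet discharged). This
file takes instead the Serrin road already built in the tree — the `k = 0` case of the paper's own
§2 p. 8 ("`z ↦ ∇ᵏv(z)` is Hölder continuous … the corresponding norms are estimated by constants
depending on `‖v‖_{3,Q}`, `‖q‖_{3/2,Q}`, `‖v‖_{∞,Q₁}` …", [ESS4], [LS], [NRS]; Robinson–Rodrigo–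
Sadowski 2016, Thm. 13.7 and §13.5) — with every constant fixed before the solution:

1. bounded distributional solutions with `L_{3/2}` pressure are suitable
   (`isSuitableWeakSolutionOn_of_bounded`), and the sliced local energy inequality up to the top
   (`dissipationE_add_energyA_le_of_suitable` on `Q(4a)` itself) bounds `∫∫_{Q(2a)} |∇u|²` by the
   data: `C(0, 4a) ≤ |Q(4a)|/(4a)²` as `|u| ≤ 1`, `D(0, 4a) ≤ c/(4a)²`;
2. on the centred cylinder `]-2a², 0[ × B(0, a) ⊆ Q(2a)` the quantitative bounded-spin /
   De Giorgi slice estimate up to the top (`SerrinTopQuant.holder_slices_top_quant`,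
   `NSVorticityBoundedTopQuant.lean`) makes the slices uniformly Hölder for a.e.
   `t ∈ ]-a² - (9a/10)², 0[` on `B(0, 9a/10)`;
3. on `]-2(9a/10)², 0[ × B(0, 9a/10)` the time regularity through the pressure
   (`SliceTimeHolderQuant.exists_holderOnWith_representative_quant`,
   `NSBoundedTimeHolderTopQuant.lean`) gives a representative `W`, `(K, κ)`-Hölder on
   `]-2(9a/10)², 0[ × B(0, 3a/4)` for the max product metric of `ℝ × ℝ³`;
4. `Q(a/2) = ]-a²/4, 0[ × 𝒞(a/2)` lies inside, since `‖x‖² = |x'|² + x₃² < a²/2 < (3a/4)²`.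

## References

* G. Seregin, V. Šverák, Comm. PDE 34 (2009) 171–201 = arXiv:0804.1803: §2 p. 8, Thm. 3.1–3.2
  (p. 9), §4 p. 11 ((p1)–(p12) and the estimates following (p12)). [`SereginSverak2009`]
* G. Seregin, *Lecture notes on regularity theory for the Navier–Stokes equations*, World
  Scientific (2014), §6.5 pp. 122–125. [`Seregin2014`]
* G. Koch, N. Nadirashvili, G. Seregin, V. Šverák, Acta Math. 203 (2009), Thm. 5.3.
  [`KochNadirashviliSereginSverak2009`]
* J. C. Robinson, J. L. Rodrigo, W. Sadowski, *The Three-Dimensional Navier–Stokes Equations*,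
  CUP 2016, Thm. 13.7, §13.3.2, §13.5. [`RobinsonRodrigoSadowskiCUP2016`]
-/

noncomputable section

open MeasureTheory Set Function Filter Topology TopologicalSpace Metric
open scoped NNReal ENNReal RealInnerProductSpace Laplacian

namespace Literature.Analysis.FluidPDE

namespace SereginSverak2009

/-! ### Geometry: product cylinders inside `Q(R)`, and `Q(a/2)` inside a ball cylinder -/

/-- A product cylinder `]t₁, t₂[ × B(0, ρ)` with `-R² ≤ t₁`, `t₂ ≤ 0`, `ρ ≤ R` lies in
`Q(R) = 𝒞(R) × ]-R², 0[` (a ball lies in the coaxial bi-cylinder of the same radius). [folklore] -/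
theorem prod_ball_subset_parCyl {t₁ t₂ ρ R : ℝ} (h₁ : -R ^ 2 ≤ t₁) (h₂ : t₂ ≤ 0) (hρ : ρ ≤ R) :
    Ioo t₁ t₂ ×ˢ ball (0 : EuclideanSpace ℝ (Fin 3)) ρ ⊆ parCyl (0 : ℝ × EuclideanSpace ℝ (Fin 3)) R := by
  intro z hz
  obtain ⟨ht, hx⟩ := hz
  rw [mem_parCyl_zero]
  have hn : ‖z.2‖ < R := (mem_ball_zero_iff.1 hx).trans_le hρ
  have hsq := norm_sq_eq_cylRadius_sq_add z.2
  have hc0 := cylRadius_nonneg z.2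
  have hn0 : 0 ≤ ‖z.2‖ := norm_nonneg _
  refine ⟨⟨lt_of_le_of_lt h₁ ht.1, lt_of_lt_of_le ht.2 h₂⟩, ?_, ?_⟩
  · have : cylRadius z.2 ≤ ‖z.2‖ := by nlinarith [sq_nonneg (z.2 2)]
    exact this.trans_lt hn
  · have : |z.2 2| ≤ ‖z.2‖ := by
      refine abs_le_of_sq_le_sq ?_ hn0
      nlinarith
    exact this.trans_lt hn

/-- Points of `𝒞(a/2)` have norm `< 3a/4` (`‖x‖² = |x'|² + x₃² < a²/2 < 9a²/16`). [folklore] -/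
theorem norm_lt_of_cyl {x : EuclideanSpace ℝ (Fin 3)} {a : ℝ} (ha : 0 < a)
    (h1 : cylRadius x < a / 2) (h2 : |x 2| < a / 2) : ‖x‖ < 3 * a / 4 := by
  have hsq := norm_sq_eq_cylRadius_sq_add x
  have hc0 := cylRadius_nonneg x
  have hx2 : x 2 ^ 2 < (a / 2) ^ 2 := by
    have := abs_lt.1 h2
    nlinarith [this.1, this.2]
  have h3 : ‖x‖ ^ 2 < (3 * a / 4) ^ 2 := by
    rw [hsq]
    nlinarith
  exact lt_of_pow_lt_pow_left₀ 2 (by positivity) h3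

/-! ### The discharge of `LocalHolderBound` -/

/-- **Seregin–Šverák 2009, §4, the uniform local Hölder bound on the blow-up sequence,
discharged**: `theorem LocalHolderBound_holds : LocalHolderBound` (arXiv:0804.1803, p. 11, the
estimates following (p12): "`‖F^k‖_{3/2,Q(4a)} ≤ c₁(a)` … By the embedding theorem, sequence
`u^k` is uniformly bounded in the parabolic Hölder space `C^{1/2}(Q̄(a/2))`"; = Seregin 2014, §6.5
p. 125). The print runs through [LSU] and the local `L_p` theory of the Stokes system [S8]; this
proof takes the Serrin road of the tree instead (the `k = 0` case of §2 p. 8, "the corresponding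
norms are estimated by constants depending on the data", Robinson–Rodrigo–Sadowski 2016,
Thm. 13.7 and §13.5), every constant being fixed before the solution:
1. bounded distributional solutions are suitable (`isSuitableWeakSolutionOn_of_bounded`), and the
   local energy inequality up to the top bounds `∫∫_{Q(2a)} |∇u|²` by the data
   (`dissipationE_add_energyA_le_of_suitable` on `Q(4a)` itself: `C(0, 4a) ≤ |Q(4a)|/(4a)²` as
   `|u| ≤ 1`, `D(0, 4a) ≤ c/(4a)²`);
2. on the centred cylinder `]-2a², 0[ × B(0, a) ⊆ Q(2a)` the slices are uniformly Hölder for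
   a.e. `t ∈ ]-a² - (9a/10)², 0[` (`SerrinTopQuant.holder_slices_top_quant`: quantitative
   bounded spin up to the top and the De Giorgi slice estimate);
3. on `]-2(9a/10)², 0[ × B(0, 9a/10)` the time regularity through the pressure gives a
   representative `W`, `(K, κ)`-Hölder on `]-2(9a/10)², 0[ × B(0, 3a/4)` for the max product
   metric (`SliceTimeHolderQuant.exists_holderOnWith_representative_quant`);
4. `Q(a/2) = ]-a²/4, 0[ × 𝒞(a/2)` lies inside (`‖x‖² = |x'|² + x₃² < a²/2 < (3a/4)²`).
[cite: SereginSverak2009, §4, (p12) and the displayed estimates following it, arXiv p. 11 (= Seregin2014 §6.5 p. 125); the k = 0 case of §2 p. 8; mechanism RobinsonRodrigoSadowskiCUP2016 Thm. 13.7 and §13.5] -/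
theorem LocalHolderBound_holds : LocalHolderBound := by
  intro a ha c
  -- radii
  set R₂ : ℝ := 9 * a / 10 with hR₂
  have h9 : 0 < R₂ := by rw [hR₂]; positivity
  have h9a : R₂ < a := by rw [hR₂]; linarith
  have h34 : 0 < 3 * a / 4 := by positivity
  have h3449 : 3 * a / 4 < R₂ := by rw [hR₂]; linarith
  -- Step 0: the constants, fixed before the solution
  obtain ⟨c₀, hc₀⟩ := dissipationE_add_energyA_le_of_suitable
  set Cb : ℝ≥0∞ := (ENNReal.ofReal (4 * a) ^ 2)⁻¹ *
    (ENNReal.ofReal 8 * volume (ball (0 : EuclideanSpace ℝ (Fin 3)) 1) * ENNReal.ofReal (4 * a) ^ 5)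
    with hCb
  set Db : ℝ≥0∞ := (ENNReal.ofReal (4 * a) ^ 2)⁻¹ * (c : ℝ≥0∞) with hDb
  set Benn : ℝ≥0∞ := ENNReal.ofReal (2 * a) * ((c₀ : ℝ≥0∞) * (Cb ^ (2 / 3 : ℝ) + Cb + Db))
    with hBenn
  have hinv : (ENNReal.ofReal (4 * a) ^ 2)⁻¹ ≠ ⊤ :=
    ENNReal.inv_ne_top.2 (pow_ne_zero _ (ENNReal.ofReal_pos.2 (by positivity)).ne')
  have hCbtop : Cb ≠ ⊤ :=
    ENNReal.mul_ne_top hinv (ENNReal.mul_ne_top (ENNReal.mul_ne_top ENNReal.ofReal_ne_top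
      measure_ball_lt_top.ne) (ENNReal.pow_ne_top ENNReal.ofReal_ne_top))
  have hDbtop : Db ≠ ⊤ := ENNReal.mul_ne_top hinv ENNReal.coe_ne_top
  have hBtop : Benn ≠ ⊤ :=
    ENNReal.mul_ne_top ENNReal.ofReal_ne_top (ENNReal.mul_ne_top ENNReal.coe_ne_top
      (ENNReal.add_ne_top.2 ⟨ENNReal.add_ne_top.2
        ⟨ENNReal.rpow_ne_top_of_nonneg (by norm_num) hCbtop, hCbtop⟩, hDbtop⟩))
  set B : ℝ≥0 := Benn.toNNReal with hB
  have hBB : (B : ℝ≥0∞) = Benn := ENNReal.coe_toNNReal hBtop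
  obtain ⟨Cs, αs, hαs, hS⟩ := SerrinTopQuant.holder_slices_top_quant h9 h9a (1 : ℝ) B
  obtain ⟨K, κ, hκ, hT⟩ :=
    SliceTimeHolderQuant.exists_holderOnWith_representative_quant h34 h3449 (1 : ℝ) c Cs αs hαs
  refine ⟨κ, K, hκ, fun u p hsol hbd hpc => ?_⟩
  -- Step 1: suitability, the weak gradient, and the energy bound on `Q(2a)`
  have hvol : volume (parCyl (0 : ℝ × EuclideanSpace ℝ (Fin 3)) (4 * a)) < ∞ :=
    lt_of_le_of_lt (volume_parCyl_le_mul_pow 0 (by positivity))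
      (ENNReal.mul_lt_top (ENNReal.mul_lt_top ENNReal.ofReal_lt_top measure_ball_lt_top)
        (ENNReal.pow_lt_top ENNReal.ofReal_lt_top))
  have hpfin : ∫⁻ z in parCyl (0 : ℝ × EuclideanSpace ℝ (Fin 3)) (4 * a),
      ‖p z.1 z.2‖ₑ ^ (3 / 2 : ℝ) < ∞ := lt_of_le_of_lt hpc ENNReal.coe_lt_top
  have hsw : IsSuitableWeakSolutionOn (parCylOpens 0 (4 * a)) 1 0 u p :=
    isSuitableWeakSolutionOn_of_bounded one_pos hsol hvol hbd hpfin
  obtain ⟨G, hG, -, -⟩ := hsw.localEnergy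
  have hu3 : LocallyIntegrableOn (fun z : ℝ × EuclideanSpace ℝ (Fin 3) => ‖u z.1 z.2‖ ^ 3)
      ((parCylOpens 0 (4 * a) : Opens (ℝ × EuclideanSpace ℝ (Fin 3))) :
        Set (ℝ × EuclideanSpace ℝ (Fin 3))) volume := by
    refine IntegrableOn.locallyIntegrableOn ?_
    rw [coe_parCylOpens]
    haveI : IsFiniteMeasure (volume.restrict (parCyl (0 : ℝ × EuclideanSpace ℝ (Fin 3)) (4 * a))) :=
      ⟨by rwa [Measure.restrict_apply_univ]⟩
    refine Integrable.of_bound (hsol.1.aestronglyMeasurable.norm.pow 3) 1 ?_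
    filter_upwards [hbd] with z hz
    rw [norm_pow, norm_norm]
    exact pow_le_one₀ (norm_nonneg _) hz
  have hE := hc₀ _ u p G hsw hu3 hG 0 (4 * a) (by positivity) (by rw [coe_parCylOpens])
  have hCle : cubicC (0 : ℝ × EuclideanSpace ℝ (Fin 3)) (4 * a) u ≤ Cb := by
    show (ENNReal.ofReal (4 * a) ^ 2)⁻¹ *
        ∫⁻ z in parCyl (0 : ℝ × EuclideanSpace ℝ (Fin 3)) (4 * a), ‖u z.1 z.2‖ₑ ^ (3 : ℕ) ≤ Cb
    rw [hCb]
    gcongr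
    calc ∫⁻ z in parCyl (0 : ℝ × EuclideanSpace ℝ (Fin 3)) (4 * a), ‖u z.1 z.2‖ₑ ^ (3 : ℕ)
        ≤ ∫⁻ _z in parCyl (0 : ℝ × EuclideanSpace ℝ (Fin 3)) (4 * a), 1 := by
          refine lintegral_mono_ae ?_
          filter_upwards [hbd] with z hz
          have h1 : ‖u z.1 z.2‖ₑ ≤ 1 := by
            rw [← ofReal_norm]
            exact ENNReal.ofReal_le_one.2 hz
          calc ‖u z.1 z.2‖ₑ ^ (3 : ℕ) ≤ 1 ^ (3 : ℕ) := by gcongr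
            _ = 1 := one_pow 3
      _ = volume (parCyl (0 : ℝ × EuclideanSpace ℝ (Fin 3)) (4 * a)) := by
          rw [setLIntegral_const, one_mul]
      _ ≤ _ := volume_parCyl_le_mul_pow 0 (by positivity)
  have hDle : pressureD (0 : ℝ × EuclideanSpace ℝ (Fin 3)) (4 * a) p ≤ Db := by
    show (ENNReal.ofReal (4 * a) ^ 2)⁻¹ *
        ∫⁻ z in parCyl (0 : ℝ × EuclideanSpace ℝ (Fin 3)) (4 * a), ‖p z.1 z.2‖ₑ ^ (3 / 2 : ℝ) ≤ Db
    rw [hDb]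
    gcongr
  have hGQ : ∫⁻ z in parCyl (0 : ℝ × EuclideanSpace ℝ (Fin 3)) (2 * a),
      ENNReal.ofReal (frobeniusNormSq (G z.1 z.2)) ≤ Benn := by
    have h1 : dissipationE (0 : ℝ × EuclideanSpace ℝ (Fin 3)) (2 * a) G ≤
        (c₀ : ℝ≥0∞) * (Cb ^ (2 / 3 : ℝ) + Cb + Db) := by
      have h2 := le_self_add.trans hE
      rw [show (4 : ℝ) * a / 2 = 2 * a by ring] at h2
      refine h2.trans ?_
      exact mul_le_mul' le_rfl (add_le_add (add_le_add (ENNReal.rpow_le_rpow hCle (by norm_num))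
        hCle) hDle)
    have h0 : ENNReal.ofReal (2 * a) ≠ 0 := (ENNReal.ofReal_pos.2 (by positivity)).ne'
    calc ∫⁻ z in parCyl (0 : ℝ × EuclideanSpace ℝ (Fin 3)) (2 * a),
          ENNReal.ofReal (frobeniusNormSq (G z.1 z.2))
        = ENNReal.ofReal (2 * a) * dissipationE (0 : ℝ × EuclideanSpace ℝ (Fin 3)) (2 * a) G := by
          rw [dissipationE, ENNReal.mul_inv_cancel_left h0 ENNReal.ofReal_ne_top]
      _ ≤ ENNReal.ofReal (2 * a) * ((c₀ : ℝ≥0∞) * (Cb ^ (2 / 3 : ℝ) + Cb + Db)) := by gcongr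
      _ = Benn := by rw [hBenn]
  -- Step 2: the centred cylinder `]-2a², 0[ × B(0, a)` and the Hölder slices
  set z₁ : ℝ × EuclideanSpace ℝ (Fin 3) := ((-a ^ 2 : ℝ), (0 : EuclideanSpace ℝ (Fin 3))) with hz₁
  have hsub₁ : parabolicCylinderCentered a z₁ ⊆ parCyl (0 : ℝ × EuclideanSpace ℝ (Fin 3)) (4 * a) := by
    show Ioo (-a ^ 2 - a ^ 2) (-a ^ 2 + a ^ 2) ×ˢ ball (0 : EuclideanSpace ℝ (Fin 3)) a ⊆ _
    exact prod_ball_subset_parCyl (by nlinarith) (by linarith) (by linarith)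
  have hsub₁' : parabolicCylinderCentered a z₁ ⊆ parCyl (0 : ℝ × EuclideanSpace ℝ (Fin 3)) (2 * a) := by
    show Ioo (-a ^ 2 - a ^ 2) (-a ^ 2 + a ^ 2) ×ˢ ball (0 : EuclideanSpace ℝ (Fin 3)) a ⊆ _
    exact prod_ball_subset_parCyl (by nlinarith) (by linarith) (by linarith)
  have hle₁ : parabolicCylinderCenteredOpens a z₁ ≤ parCylOpens 0 (4 * a) := fun z hz => hsub₁ hz
  have hsol₁ : IsDistributionalNSSolutionOn (parabolicCylinderCenteredOpens a z₁) 1 0 u p :=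
    hsol.of_le hle₁
  have hbd₁ : ∀ᵐ w ∂(volume.restrict (parabolicCylinderCentered a z₁)), ‖u w.1 w.2‖ ≤ 1 :=
    ae_restrict_of_ae_restrict_of_subset hsub₁ hbd
  have hG₁ : HasWeakSpatialGradientOn (parabolicCylinderCenteredOpens a z₁) u G := hG.mono hle₁
  have hGB₁ : ∫⁻ w in parabolicCylinderCentered a z₁,
      ENNReal.ofReal (frobeniusNormSq (G w.1 w.2)) ≤ B := by
    rw [hBB]
    exact (lintegral_mono_set hsub₁').trans hGQ
  have hslices := hS u p G hsol₁ hbd₁ hG₁ hGB₁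
  -- Step 3: the space–time Hölder representative on `]-2 R₂², 0[ × B(0, 3a/4)`, `R₂ = 9a/10`
  set z₂ : ℝ × EuclideanSpace ℝ (Fin 3) := ((-R₂ ^ 2 : ℝ), (0 : EuclideanSpace ℝ (Fin 3))) with hz₂
  have hsub₂ : parabolicCylinderCentered R₂ z₂ ⊆ parCyl (0 : ℝ × EuclideanSpace ℝ (Fin 3)) (4 * a) := by
    show Ioo (-R₂ ^ 2 - R₂ ^ 2) (-R₂ ^ 2 + R₂ ^ 2) ×ˢ ball (0 : EuclideanSpace ℝ (Fin 3)) R₂ ⊆ _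
    exact prod_ball_subset_parCyl (by nlinarith) (by nlinarith) (by linarith)
  have hle₂ : parabolicCylinderCenteredOpens R₂ z₂ ≤ parCylOpens 0 (4 * a) := fun z hz => hsub₂ hz
  have hsol₂ : IsDistributionalNSSolutionOn (parabolicCylinderCenteredOpens R₂ z₂) 1 0 u p :=
    hsol.of_le hle₂
  have hbd₂ : ∀ᵐ w ∂(volume.restrict (parabolicCylinderCentered R₂ z₂)), ‖u w.1 w.2‖ ≤ 1 :=
    ae_restrict_of_ae_restrict_of_subset hsub₂ hbd
  have hp₂ : ∫⁻ w in parabolicCylinderCentered R₂ z₂, ‖p w.1 w.2‖ₑ ^ (3 / 2 : ℝ) ≤ c :=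
    (lintegral_mono_set hsub₂).trans hpc
  have hH₂ : ∀ᵐ t ∂(volume.restrict (Ioo (z₂.1 - R₂ ^ 2) (z₂.1 + R₂ ^ 2))),
      ∃ v : EuclideanSpace ℝ (Fin 3) → EuclideanSpace ℝ (Fin 3),
        HolderOnWith Cs αs v (ball z₂.2 R₂) ∧ u t =ᵐ[volume.restrict (ball z₂.2 R₂)] v := by
    have hI : Ioo (z₂.1 - R₂ ^ 2) (z₂.1 + R₂ ^ 2) ⊆ Ioo (-a ^ 2 - R₂ ^ 2) 0 := by
      show Ioo (-R₂ ^ 2 - R₂ ^ 2) (-R₂ ^ 2 + R₂ ^ 2) ⊆ Ioo (-a ^ 2 - R₂ ^ 2) 0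
      exact Ioo_subset_Ioo (by nlinarith) (by linarith)
    exact ae_restrict_of_ae_restrict_of_subset hI hslices
  obtain ⟨W, hW, hWae⟩ := hT u p z₂ hsol₂ hbd₂ hp₂ hH₂
  -- Step 4: `Q(a/2)` lies inside `]-2 R₂², 0[ × B(0, 3a/4)`
  have hsub₃ : parCyl (0 : ℝ × EuclideanSpace ℝ (Fin 3)) (a / 2) ⊆
      Ioo (z₂.1 - R₂ ^ 2) (z₂.1 + R₂ ^ 2) ×ˢ ball z₂.2 (3 * a / 4) := by
    intro z hz
    rw [mem_parCyl_zero] at hz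
    obtain ⟨⟨ht1, ht2⟩, hr, hx3⟩ := hz
    refine ⟨⟨?_, ?_⟩, ?_⟩
    · show -R₂ ^ 2 - R₂ ^ 2 < z.1
      rw [hR₂]
      nlinarith
    · show z.1 < -R₂ ^ 2 + R₂ ^ 2
      linarith
    · show z.2 ∈ ball (0 : EuclideanSpace ℝ (Fin 3)) (3 * a / 4)
      rw [mem_ball_zero_iff]
      exact norm_lt_of_cyl ha hr hx3
  have hWae' : uncurry u =ᵐ[volume.restrict (parCyl (0 : ℝ × EuclideanSpace ℝ (Fin 3)) (a / 2))] W :=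
    ae_restrict_of_ae_restrict_of_subset hsub₃ hWae
  exact ⟨W, hWae'.symm, hW.mono hsub₃⟩

/-! ### Consequences: the blow-up step and Theorem 3.2, unconditionally -/

/-- **Seregin–Šverák 2009, §4, the compactness of the blow-up sequence, discharged**
(`BlowupCompactness_holds`): `blowupCompactness_of_localHolderBound LocalHolderBound_holds`.
[cite: SereginSverak2009, §4 (p5)–(p12) and the estimates following (p12) (arXiv p. 11)] -/
theorem BlowupCompactness_holds : BlowupCompactness :=
  blowupCompactness_of_localHolderBound LocalHolderBound_holds

/-- **Seregin–Šverák 2009, §4, the blow-up step of the proof of Theorems 3.1–3.2, discharged**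
(`BlowupAlternative_holds`): the accepted assembly `blowupAlternative_of_library_facts`
(`SereginSverakBlowupAlternativeAssembly.lean`: the near-maximum selection, the axis-centred
rescaling with the uniform Lemma 3.6, interior continuity from `NSBoundedSpatialHolder`, and the
compactness of the blow-up sequence from `LocalHolderBound`) applied to
`NSBoundedSpatialHolder_holds` and `LocalHolderBound_holds`.
[cite: SereginSverak2009, §4 (proof of Thms. 3.1–3.2, (p1)–(p11), arXiv p. 11)] -/
theorem BlowupAlternative_holds : BlowupAlternative :=
  blowupAlternative_of_library_facts NSBoundedSpatialHolder_holds LocalHolderBound_holds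

/-- **Seregin–Šverák 2009, §4 for Theorem 3.1, the blow-up alternative under Type I,
discharged** (`BlowupAlternativeTypeI_holds`): `blowupAlternativeTypeI_of_localHolderBound`
with `InteriorContinuity_holds` and `LocalHolderBound_holds`.
[cite: SereginSverak2009, §4 (proof of Thm. 3.1, (p1)–(p11), arXiv p. 11)] -/
theorem BlowupAlternativeTypeI_holds : BlowupAlternativeTypeI :=
  blowupAlternativeTypeI_of_localHolderBound InteriorContinuity_holds LocalHolderBound_holds

/-- **Seregin–Šverák 2009, Theorem 3.2, unconditionally** (arXiv p. 9: "Assume that functions `v`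
and `q` satisfy the standing assumptions, `v` is axially symmetric, (r2) holds, and (r4)
`|v(x,t)| ≤ C/|x'|` a.e. in `Q`. Then `z = 0` is a regular point of `v`"): the accepted assembly
`isRegularAtOrigin_of_axisDecay_of_library_facts` fed with `NSBoundedSpatialHolder_holds`,
`LocalHolderBound_holds` and KNSS 2009, Thm. 5.3 (`KNSS2009_liouville_bound_C_over_r_holds`).
[cite: SereginSverak2009, Thm. 3.2 (arXiv p. 9) with its proof §4 (p. 11) and Lemma 3.6] -/
theorem isRegularAtOrigin_of_axisDecay_holds
    {u : ℝ → EuclideanSpace ℝ (Fin 3) → EuclideanSpace ℝ (Fin 3)}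
    {p : ℝ → EuclideanSpace ℝ (Fin 3) → ℝ}
    (hsol : IsAxisymmetricLocalSolution u p) (hr2 : IsBoundedAwayFromZero u)
    (hr4 : IsAxisDecayOnCyl u) : IsRegularAtOrigin u :=
  isRegularAtOrigin_of_axisDecay_of_library_facts NSBoundedSpatialHolder_holds LocalHolderBound_holds
    KNSS2009_liouville_bound_C_over_r_holds hsol hr2 hr4

/-- **Seregin–Šverák 2009, Theorem 3.1, conditional on Prop. 3.7 only**: with Lemma 3.5
(`ScaledEnergyBound_holds`), the Type I blow-up alternative (`BlowupAlternativeTypeI_holds`) and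
KNSS 2009, Thm. 5.3 (`KNSS2009_liouville_bound_C_over_r_holds`) discharged, an axially symmetric
distributional solution in `Q` with the Type I bound (r3) is regular at the origin as soon as the
axis decay bound of Prop. 3.7 (`AxisDecayBound`) is available.
[cite: SereginSverak2009, Thm. 3.1 and §4 (arXiv pp. 9–11)] -/
theorem isRegularAtOrigin_of_typeI_of_axisDecayBound (h37 : AxisDecayBound)
    {u : ℝ → EuclideanSpace ℝ (Fin 3) → EuclideanSpace ℝ (Fin 3)}
    {p : ℝ → EuclideanSpace ℝ (Fin 3) → ℝ}
    (hsol : IsAxisymmetricLocalSolution u p) (hI : IsTypeIOnCyl u) : IsRegularAtOrigin u :=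
  isRegularAtOrigin_of_typeI' ScaledEnergyBound_holds h37 BlowupAlternativeTypeI_holds
    KNSS2009_liouville_bound_C_over_r_holds hsol hI

end SereginSverak2009

end Literature.Analysis.FluidPDE

end
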